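import Summits.RiemannHypothesis.RiemannHypothesis.Theorems.SignConeEnvelopeCore
import Literature.NumberTheory.LFunctions.WeilFirstPrimePositivityC

/-!
# The sign-cone inequality at finite cutoffs; the unconditional rung `a ≤ (log 3)/2`
(route `SignCone`, item stmt-RiemannHypothesis-16302 `SignConeOscillatory`; compare item `SignConeUpTo210`)

The core estimate of `SignConeEnvelopeCore.lean` has no slack to spare: `Re W_ar(F) ≥ 0`
(`W_ar = weilPolarTerm + weilArchTerm`) for a node-nonnegative finite sum of autocorrelations `F = Σᵢ gᵢ ⋆ g̃ᵢ`
as soon as every `Re Q(gᵢ) ≥ 0`. At a FIXED cutoff `a` this needs only `WeilPositivityOn a`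
(`tsupport gᵢ ⊆ [-a, a]`), and `WeilPositivityOn a` is a THEOREM of the tree for `a ≤ (log 3)/2`
(`weilPositivityOn_log_three_half`: the kernel-checked first-prime certificate of `WeilFirstPrimePositivityC.lean`,
extending Yoshida's archimedean range `a ≤ (log 2)/2`). Consequences, all unconditional:

* `re_weilArchPolar_nonneg`, `re_apply_zero_nonneg` — exact form of the core estimate and `Re F(0) ≥ 0`;
* `re_weilArchPolar_nonneg_of_weilPositivityOn` — per-cutoff envelope;
* `signConeExact_upTo_log_three_half` — the EXACT sign-cone inequality `0 ≤ Re W_ar(F)` for every cutoff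
  `a ≤ (log 3)/2` (the statement of `SignConeUpTo210` with `210` replaced by `3`: its first non-archimedean rung);
* `signConeOscillatory_upTo_log_three_half` — the item `SignConeOscillatory` restricted to cutoffs
  `a ≤ (log 3)/2`; this range is NOT vacuous: the oscillatory node-nonnegative class is non-empty as soon as
  `2a > log 2` (two opposite narrow bumps `b(u) - b(u - c)`, `log 2 < c < 2a`, straddling no node).

Beyond `(log 3)/2` the item is open; by the route's own account (`ConeMagnification`, `SignConeDuality`) the
family of all cutoffs is RH-strength. The bodies of the last two theorems are the route statements verbatim
(Mathlib primitives) with the extra hypothesis `a ≤ Real.log 3 / 2`.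
-/

noncomputable section

-- `Summit.RiemannHypothesis.RiemannHypothesis.…` repeats a namespace component by design (D-0017 layout).
set_option linter.dupNamespace false

open scoped BigOperators ComplexConjugate
open Complex MeasureTheory Set Filter

namespace Summit.RiemannHypothesis.RiemannHypothesis.Theorems.SignCone

open Literature.NumberTheory.LFunctions
open Summit.RiemannHypothesis.RiemannHypothesis.Theorems.RuelleBandCofiniteCriticalLine

/-! ## Exact form of the core estimate -/

/-- Exact form of the core estimate: `0 ≤ Re W_ar(F)` (no slack) for a node-nonnegative finite sum of
autocorrelations whose summands have `Re Q(gᵢ) ≥ 0`. [folklore] -/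
theorem re_weilArchPolar_nonneg {k : ℕ} {g : Fin k → ℝ → ℂ} {F : ℝ → ℂ}
    (hF : F = fun t => ∑ i, weilConv (g i) (weilReflect (g i)) t)
    (hg : ∀ i, IsWeilTest (g i)) (hQ : ∀ i, 0 ≤ (weilQuadratic (g i)).re)
    (hn : ∀ n : ℕ, 2 ≤ n → 0 ≤ (F (Real.log n)).re) :
    0 ≤ (weilPolarTerm F + weilArchTerm F).re := by
  have hGi : ∀ i, IsWeilTest (weilConv (g i) (weilReflect (g i))) := fun i =>
    (hg i).weilConv (hg i).weilReflect
  have hFt : IsWeilTest F := by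
    rw [hF]
    exact stub_branchesContinuous_isWeilTest_sum _ fun i _ => hGi i
  have hdec : weilPolarTerm F + weilArchTerm F = weilFunctional F + weilPrimeTerm F := by
    unfold weilFunctional
    ring
  have hW : weilFunctional F = ∑ i, weilQuadratic (g i) := by
    rw [hF, stub_branchesContinuous_weilFunctional_sum _ fun i _ => hGi i]
    rfl
  have hWre : 0 ≤ (weilFunctional F).re := by
    rw [hW, Complex.re_sum]
    exact Finset.sum_nonneg fun i _ => hQ i
  have hsym : ∀ t : ℝ, conj (F (-t)) = F t := by
    intro t
    simp only [hF, map_sum, conj_weilConv_weilReflect_neg]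
  have hPre : 0 ≤ (weilPrimeTerm F).re := re_weilPrimeTerm_nonneg hFt.2 hsym hn
  rw [hdec, Complex.add_re]
  linarith

/-- `Re F(0) = Σᵢ ‖gᵢ‖₂² ≥ 0` for a finite sum of autocorrelations. [folklore] -/
theorem re_apply_zero_nonneg {k : ℕ} {g : Fin k → ℝ → ℂ} {F : ℝ → ℂ}
    (hF : F = fun t => ∑ i, weilConv (g i) (weilReflect (g i)) t) : 0 ≤ (F 0).re := by
  rw [hF]
  simp only [Complex.re_sum, weilConv_weilReflect_apply_zero, Complex.ofReal_re]
  exact Finset.sum_nonneg fun i _ => integral_nonneg fun t => by positivity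

/-- Per-cutoff envelope: `WeilPositivityOn a` and `tsupport gᵢ ⊆ [-a, a]` give the EXACT sign-cone inequality
`0 ≤ Re W_ar(F)` at cutoff `a`. [folklore] -/
theorem re_weilArchPolar_nonneg_of_weilPositivityOn {a : ℝ} (hWa : WeilPositivityOn a) {k : ℕ}
    {g : Fin k → ℝ → ℂ} {F : ℝ → ℂ} (hF : F = fun t => ∑ i, weilConv (g i) (weilReflect (g i)) t)
    (hg : ∀ i, IsWeilTest (g i)) (hsupp : ∀ i, tsupport (g i) ⊆ Icc (-a) a)
    (hn : ∀ n : ℕ, 2 ≤ n → 0 ≤ (F (Real.log n)).re) :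
    0 ≤ (weilPolarTerm F + weilArchTerm F).re :=
  re_weilArchPolar_nonneg hF hg (fun i => hWa _ (hg i) (hsupp i)) hn

/-- **Unconditional rung.** For `a ≤ (log 3)/2` the exact sign-cone inequality `0 ≤ Re W_ar(F)` holds on the
whole sign cone at cutoff `a` (first-prime Weil positivity `weilPositivityOn_log_three_half`). [folklore] -/
theorem re_weilArchPolar_nonneg_of_le_log_three_half {a : ℝ} (ha : a ≤ Real.log 3 / 2) {k : ℕ}
    {g : Fin k → ℝ → ℂ} {F : ℝ → ℂ} (hF : F = fun t => ∑ i, weilConv (g i) (weilReflect (g i)) t)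
    (hg : ∀ i, IsWeilTest (g i)) (hsupp : ∀ i, tsupport (g i) ⊆ Icc (-a) a)
    (hn : ∀ n : ℕ, 2 ≤ n → 0 ≤ (F (Real.log n)).re) :
    0 ≤ (weilPolarTerm F + weilArchTerm F).re :=
  re_weilArchPolar_nonneg_of_weilPositivityOn (WeilPositivityOn.mono ha weilPositivityOn_log_three_half)
    hF hg hsupp hn

/-- **The exact sign-cone inequality up to cutoff `(log 3)/2`, unconditionally** — the statement of the
route item `SignConeUpTo210` with `(log 210)/2` replaced by `(log 3)/2` (its first non-archimedean rung; the
sub-case `a ≤ (log 2)/2` is Yoshida's). Body verbatim over Mathlib primitives. [folklore] -/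
theorem signConeExact_upTo_log_three_half :
    ∀ a : ℝ, 0 < a → a ≤ Real.log 3 / 2 → ∀ (k : ℕ) (g : Fin k → ℝ → ℂ), (∀ i, (ContDiff ℝ ((⊤ : ℕ∞) : WithTop ℕ∞) (g i) ∧ HasCompactSupport (g i)) ∧ tsupport (g i) ⊆ Set.Icc (-a) a) → let F : ℝ → ℂ := fun t => ∑ i, MeasureTheory.convolution (g i) (fun u => (starRingEnd ℂ) ((g i) (-u))) (ContinuousLinearMap.mul ℂ ℂ) MeasureTheory.MeasureSpace.volume t; (∀ n : ℕ, 2 ≤ n → 0 ≤ (F (Real.log n)).re) → let M : ℂ → ℂ := fun s => ∫ u : ℝ, F u * Complex.exp ((s - 1 / 2) * u); 0 ≤ (M 0 + M 1 + ((1 / (2 * Real.pi) : ℂ) * (∫ t : ℝ, M (1 / 2 + t * Complex.I) * ((Complex.digamma (1 / 4 + t / 2 * Complex.I)).re : ℂ)) - F 0 * (Real.log Real.pi : ℂ))).re := by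
  intro a _ha ha3 k g hg F hn M
  exact re_weilArchPolar_nonneg_of_le_log_three_half ha3 (g := g) (F := F) rfl (fun i => (hg i).1)
    (fun i => (hg i).2) hn

/-- **`SignConeOscillatory` up to cutoff `(log 3)/2`, unconditionally** — the statement of the route item
`SignConeOscillatory` (stmt-RiemannHypothesis-16302) with the extra hypothesis `a ≤ Real.log 3 / 2`; the
range `(log 2)/2 < a ≤ (log 3)/2` is NOT vacuous (the oscillatory node-nonnegative class is non-empty as soon
as `2a > log 2`). Beyond `(log 3)/2` the item is open (RH-strength by the route's own account). [folklore] -/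
theorem signConeOscillatory_upTo_log_three_half :
    ∀ a : ℝ, 0 < a → a ≤ Real.log 3 / 2 → ∀ (k : ℕ) (g : Fin k → ℝ → ℂ), (∀ i, (ContDiff ℝ ((⊤ : ℕ∞) : WithTop ℕ∞) (g i) ∧ HasCompactSupport (g i)) ∧ tsupport (g i) ⊆ Set.Icc (-a) a) → let F : ℝ → ℂ := fun t => ∑ i, MeasureTheory.convolution (g i) (fun u => (starRingEnd ℂ) ((g i) (-u))) (ContinuousLinearMap.mul ℂ ℂ) MeasureTheory.MeasureSpace.volume t; (∀ n : ℕ, 2 ≤ n → 0 ≤ (F (Real.log n)).re) → (∃ t : ℝ, Real.log 2 ≤ |t| ∧ (F t).re < 0) → let M : ℂ → ℂ := fun s => ∫ u : ℝ, F u * Complex.exp ((s - 1 / 2) * u); -(F 0).re ≤ (M 0 + M 1 + ((1 / (2 * Real.pi) : ℂ) * (∫ t : ℝ, M (1 / 2 + t * Complex.I) * ((Complex.digamma (1 / 4 + t / 2 * Complex.I)).re : ℂ)) - F 0 * (Real.log Real.pi : ℂ))).re := by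
  intro a _ha ha3 k g hg F hn _hosc M
  have h1 := re_weilArchPolar_nonneg_of_le_log_three_half ha3 (g := g) (F := F) rfl (fun i => (hg i).1)
    (fun i => (hg i).2) hn
  have h0 := re_apply_zero_nonneg (g := g) (F := F) rfl
  have h : -(F 0).re ≤ (weilPolarTerm F + weilArchTerm F).re := by linarith
  exact h

end Summit.RiemannHypothesis.RiemannHypothesis.Theorems.SignCone

end
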